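import Summits.BirchSwinnertonDyer.BirchSwinnertonDyer.Theorems.PrintCf2RamifiedOffTYZQFormDualCofactor
import Literature.NumberTheory.EllipticCurves.CongruentNumberOddMonskySelmerLocal
import HarnessLib

/-!
# Route `PrintCf2`, crux stmt-BirchSwinnertonDyer-20509 `RamifiedOffTYZOfFacts` — THE EVEN Ω-IDENTITY, ROW (ii) (`x_im x_2`), ABSTRACT FOREST FORM
# (cell `bsd-print-cf2`, LEAD of 20509 g14, line `offtyz-v7`, cycle 15; kernel helpers `--supports stmt-BirchSwinnertonDyer-20509`)

Row (ii) of LEAD g13's research statement `EvenOmegaMatrixIdentity` (crux workfile `Cruxes/RamifiedOffTYZOfFacts/Lines/offtyz_v7_EvenOmega.lean`;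
proof: `Lines/offtyz_v7_EvenOmegaProof.md` §4, LEAD g14), in the abstract vocabulary of the tree's bipartite forest formula: arc weights
`a : V → V → 𝔽₂` under the RECIPROCITY LAW `a s t + a t s = y_s y_t`, a second vector `z`, `Σ_D y = 1`.  With `N = bigN a D y z z`
(for Monsky's data: `M_even · Sw`), `W′(T) = det(bigN a T y z 0)` (`= det M_{d_T}`, the uniform dictionary of `…QFormDualCofactor` §2) and
`det(lap a S (y+z))` (`= det(A_S + D₋₂(S)) = κ^S_∞`, the `√2`-coordinate of the kernel sum of the even block `2d_S`):

  **(ii)**  `Σ_{S ⊆ D} (Σ_S y) · det(lap a S (y+z)) · W′(D∖S) = Σ_{j ∈ D} y_j · (adj(N)_{(inl j)(inl j)} + adj(N)_{(inr j)(inr j)})`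

(`row_two_identity`).  Proof (§1–§2): the right side is the tree's doubly pointed forest sum `Σ_B (Σ_B y)(q_y + q_z)(B)·setExp(fwt a y z z)(D∖B)`
(`sum_mul_adjugate_bigN_inl_add_inr`); on the left `det(lap a S (y+z)) = setExp(q_{y+z})(S)`, pointing by `y` (`setExp_point`) and root
absorption (`setExp_fwt_add_root`) give `Σ_B (Σ_B y) q_{y+z}(B)·setExp(fwt a y z (y+z))(D∖B)`; finally `fwt a y z (z+y) = fwt a y z z + q_y`, and in
`setExp(fwt a y z (z + y))(R) = Σ_{X⊆R} setExp(q_y)(X)·det(bigN a (R∖X) y z z)` every `X ≠ ∅` term dies: `setExp(q_y)(X) = (Σ_X y) q_y(X)`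
(reciprocity lemma), `det bigN a (R∖X) y z z = (1 + Σ_{R∖X} y)·(…)` (marks into roots), and `(Σ_B y)(Σ_X y)(1 + Σ_{R∖X} y) = 0` because the
three sums add up to `Σ_D y = 1`.  Pure linear algebra over `𝔽₂`; no number theory, no `sorry`.  BSD is not proved by any of this; no class is closed.

References: [cite: Chaiken1982, §2 (all minors matrix tree theorem)]; [cite: Stanley1999EC2, Cor. 5.1.6]; [cite: Smith2016CongruentDensity, §2.2];
[cite: HeathBrown1994SelmerCongruentII, Appendix (Monsky), typescript p. 41 L20–L36]; crux notes `Lines/offtyz_v7_EvenOmegaProof.md` §4.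
-/

namespace Summit.BirchSwinnertonDyer.PrintCf2.QFormForest

open Matrix Finset Literature.LinearAlgebra.Matrix Literature.Combinatorics.Enumerative
open Literature.NumberTheory.EllipticCurves.Smith2016

variable {V : Type*} [Fintype V] [LinearOrder V]

/-! ## §1. The left side as a pointed forest sum -/

/-- **Pointing and root absorption on the left side of row (ii)** (no hypothesis):
`Σ_{S ⊆ D} (Σ_S y)·det(lap a S ℓ)·det(bigN a (D∖S) y z 0) = Σ_{B ⊆ D} (Σ_B y)·q_ℓ(B)·det(bigN a (D∖B) y z ℓ)` — `det(lap a S ℓ) = setExp(q_ℓ)(S)`,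
point the block `B` by `y` (`setExp_point`), and re-assemble `setExp(q_ℓ) ⋆ setExp(fwt a y z 0) = setExp(fwt a y z ℓ)` (root absorption).
[cite: Chaiken1982, §2] [cite: Stanley1999EC2, Cor. 5.1.6 (exponential formula: pointing, convolution)] -/
theorem sum_point_det_lap_mul_det_bigN_zero_root (a : V → V → ZMod 2) (y z ℓ : V → ZMod 2) (D : Finset V) :
    ∑ S ∈ D.powerset, (∑ i ∈ S, y i) * (lap a S ℓ).det * (bigN a (D \ S) y z 0).det =
      ∑ B ∈ D.powerset, (∑ i ∈ B, y i) * qwt a ℓ B * (bigN a (D \ B) y z ℓ).det := by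
  classical
  have hstep : ∀ S ∈ D.powerset, (∑ i ∈ S, y i) * (lap a S ℓ).det * (bigN a (D \ S) y z 0).det =
      ∑ B ∈ S.powerset, (∑ i ∈ B, y i) * qwt a ℓ B * setExp (qwt a ℓ) (S \ B) * setExp (fwt a y z 0) (D \ S) := by
    intro S _
    rw [det_lap_eq_setExp, det_bigN_eq_setExp, ← setExp_point y (qwt a ℓ) S, sum_mul]
    exact sum_congr rfl fun B _ => by ring
  rw [sum_congr rfl hstep, sum_powerset_sum_powerset_sub]
  refine sum_congr rfl fun B hB => ?_
  have hC : ∀ C ∈ (D \ B).powerset,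
      (∑ i ∈ B, y i) * qwt a ℓ B * setExp (qwt a ℓ) ((B ∪ C) \ B) * setExp (fwt a y z 0) (D \ (B ∪ C)) =
        (∑ i ∈ B, y i) * qwt a ℓ B * (setExp (qwt a ℓ) C * setExp (fwt a y z 0) ((D \ B) \ C)) := by
    intro C hC
    rw [mem_powerset] at hC
    obtain ⟨h1, h2⟩ := union_sdiff_bookkeeping hC
    rw [h1, h2, mul_assoc]
  rw [sum_congr rfl hC, ← mul_sum, ← setExp_fwt_add_root, det_bigN_eq_setExp]
  have hℓ : (fun i => (0 : V → ZMod 2) i + ℓ i) = ℓ := by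
    funext i
    rw [Pi.zero_apply, zero_add]
  rw [hℓ]

/-! ## §2. Row (ii) -/

/-- **ROW (ii) OF THE EVEN Ω-IDENTITY, ABSTRACT FORM.**  Under the reciprocity law on `D` with `Σ_D y = 1`:
`Σ_{S ⊆ D} (Σ_S y)·det(lap a S (y+z))·det(bigN a (D∖S) y z 0) = Σ_{j∈D} y_j·(adj(N)_{(inl j)(inl j)} + adj(N)_{(inr j)(inr j)})`, `N = bigN a D y z z`.
For Monsky's data (`a` = additive Legendre weights, `y = ((−1/pᵢ)₊)`, `z = ((2/pᵢ)₊)`, `Σ y = 1` i.e. `∏pᵢ ≡ 3 (mod 4)`): the left side is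
`Σ_S [d_{Sᶜ} ≡ 1 (8)]·det M_{d_{Sᶜ}}·κ^S_∞` (the `x_im x_2`-coefficient of the even square form) and the right side is `Σ_j t_j (A′_j + A_j)`
(the `x_im x_2`-coefficient of the even Ω-form). [cite: Chaiken1982, §2] [cite: Stanley1999EC2, Cor. 5.1.6] [cite: Smith2016CongruentDensity, §2.2]
[cite: HeathBrown1994SelmerCongruentII, Appendix (Monsky), typescript p. 41 L20–L36] -/
theorem row_two_identity (a : V → V → ZMod 2) (y z : V → ZMod 2) {D : Finset V}
    (hrec : ∀ s ∈ D, ∀ j ∈ D, s ≠ j → a s j + a j s = y s * y j) (hyD : ∑ i ∈ D, y i = 1) :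
    ∑ S ∈ D.powerset, (∑ i ∈ S, y i) * (lap a S (fun i => y i + z i)).det * (bigN a (D \ S) y z 0).det =
      ∑ j ∈ D, y j * ((bigN a D y z z).adjugate (Sum.inl j) (Sum.inl j) + (bigN a D y z z).adjugate (Sum.inr j) (Sum.inr j)) := by
  classical
  rw [sum_point_det_lap_mul_det_bigN_zero_root, sum_mul_adjugate_bigN_inl_add_inr]
  refine sum_congr rfl fun B hB => ?_
  rw [mem_powerset] at hB
  -- the pointed weights agree: `(Σ_B y) q_z + (Σ_B y) q_y = (Σ_B y) q_{y+z}`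
  rw [qwt_add, ← det_bigN_eq_setExp]
  -- `fwt a y z (y+z) = fwt a y z (z + y)`: split off `q_y` by root absorption
  have hroot : (bigN a (D \ B) y z (fun i => y i + z i)).det =
      ∑ X ∈ (D \ B).powerset, setExp (qwt a y) X * setExp (fwt a y z z) ((D \ B) \ X) := by
    rw [det_bigN_eq_setExp, ← setExp_fwt_add_root]
    congr 2
    funext i
    exact add_comm _ _
  rw [hroot, ← add_sum_erase _ _ (empty_mem_powerset (D \ B)), setExp_empty, one_mul, sdiff_empty, ← det_bigN_eq_setExp]
  -- every `X ≠ ∅` term vanishes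
  have h0 : (∑ i ∈ B, y i) * ∑ X ∈ ((D \ B).powerset).erase ∅, setExp (qwt a y) X * setExp (fwt a y z z) ((D \ B) \ X) = 0 := by
    rw [mul_sum]
    refine sum_eq_zero fun X hX => ?_
    obtain ⟨hXne, hX⟩ := mem_erase.mp hX
    rw [mem_powerset] at hX
    have hXD : X ⊆ D := hX.trans sdiff_subset
    have hRD : (D \ B) \ X ⊆ D := sdiff_subset.trans sdiff_subset
    rw [setExp_qwt_eq_sum_mul_qwt a y (nonempty_iff_ne_empty.mpr hXne) (hrec_mono hXD hrec), ← det_bigN_eq_setExp,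
      det_bigN_mark_eq a y z (hrec_mono hRD hrec)]
    -- the three `y`-sums add up to `Σ_D y = 1`
    have hsplit : ∑ i ∈ D, y i = ∑ i ∈ B, y i + (∑ i ∈ X, y i + ∑ i ∈ (D \ B) \ X, y i) := by
      rw [← sum_union disjoint_sdiff, union_sdiff_of_subset hX, ← sum_union disjoint_sdiff, union_sdiff_of_subset hB]
    rw [hyD] at hsplit
    have e : ∀ u v w q d : ZMod 2, 1 = u + (v + w) → u * (v * q * ((1 + w) * d)) = 0 := by decide
    exact e _ _ _ _ _ hsplit
  linear_combination (qwt a y B + qwt a z B) * h0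

section MonskyEven

open Literature.NumberTheory.EllipticCurves.HeathBrown1994 Literature.NumberTheory.EllipticCurves.MonskySelmerParity
open Summit.BirchSwinnertonDyer.PrintCf2.QForm

variable {k : ℕ} (p : Fin k → ℕ) (hp : ∀ i, (p i).Prime) (hp2 : ∀ i, p i ≠ 2) (hinj : Function.Injective p)

/-! ## §3. Row (ii) for Monsky's even matrix -/

include hp hp2 hinj in
/-- **ROW (ii) FOR MONSKY'S EVEN MATRIX** (ambient form): for distinct odd primes with `∏ pᵢ ≡ 3 (mod 4)` (`Σ t = 1`),
`Σ_{S ⊆ univ} (Σ_S t) · det(lap a S (t+z)) · coblockWeight p S = Σ_j t_j · (adj(M_even)_{(inr j)(inl j)} + adj(M_even)_{(inl j)(inr j)})`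
(`lap a S (t+z) = A_S + D₋₂(S)` padded by the identity, whose determinant is `κ^S_∞`; `coblockWeight p S = det M_{d_{Sᶜ}}`; on the right
`Σ_j t_j (A′_j + A_j)`). The uniform dictionary `coblockWeight_eq_det_bigN_zero_root` and the column swaps reduce it to `row_two_identity`.
[cite: HeathBrown1994SelmerCongruentII, Appendix (Monsky), typescript p. 39 L10 – p. 41 L36] [cite: Chaiken1982, §2] -/
theorem row_two_monskyMatrixEven (h3 : ∑ i, addLegendreSym (-1) (p i) = 1) :
    ∑ S ∈ (univ : Finset (Fin k)).powerset, (∑ i ∈ S, addLegendreSym (-1) (p i)) *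
        (lap (fun i j => legendreMatrix p i j) S (fun i => addLegendreSym (-1) (p i) + addLegendreSym 2 (p i))).det * coblockWeight p S =
      ∑ j, addLegendreSym (-1) (p j) *
        ((monskyMatrixEven p).adjugate (Sum.inr j) (Sum.inl j) + (monskyMatrixEven p).adjugate (Sum.inl j) (Sum.inr j)) := by
  have hS : ∀ S ∈ (univ : Finset (Fin k)).powerset, (∑ i ∈ S, addLegendreSym (-1) (p i)) *
      (lap (fun i j => legendreMatrix p i j) S (fun i => addLegendreSym (-1) (p i) + addLegendreSym 2 (p i))).det * coblockWeight p S =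
      (∑ i ∈ S, addLegendreSym (-1) (p i)) *
        (lap (fun i j => legendreMatrix p i j) S (fun i => addLegendreSym (-1) (p i) + addLegendreSym 2 (p i))).det *
          (bigN (fun i j => legendreMatrix p i j) (univ \ S) (fun i => addLegendreSym (-1) (p i)) (fun i => addLegendreSym 2 (p i)) 0).det := by
    intro S _
    rw [coblockWeight_eq_det_bigN_zero_root p hp hp2 hinj S, compl_eq_univ_sdiff]
  have hj : ∀ j ∈ (univ : Finset (Fin k)), addLegendreSym (-1) (p j) *
      ((monskyMatrixEven p).adjugate (Sum.inr j) (Sum.inl j) + (monskyMatrixEven p).adjugate (Sum.inl j) (Sum.inr j)) =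
      addLegendreSym (-1) (p j) *
        ((bigN (fun i j => legendreMatrix p i j) univ (fun i => addLegendreSym (-1) (p i)) (fun i => addLegendreSym 2 (p i))
            (fun i => addLegendreSym 2 (p i))).adjugate (Sum.inl j) (Sum.inl j) +
          (bigN (fun i j => legendreMatrix p i j) univ (fun i => addLegendreSym (-1) (p i)) (fun i => addLegendreSym 2 (p i))
            (fun i => addLegendreSym 2 (p i))).adjugate (Sum.inr j) (Sum.inr j)) := by
    intro j _
    rw [adjugate_monskyMatrixEven_inr_inl, adjugate_monskyMatrixEven_inl_inr]
  rw [sum_congr rfl hS, sum_congr rfl hj]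
  exact row_two_identity _ _ _ (hrec_legendre p hp hp2 hinj) h3

include hp hp2 in
/-- **Census coordinates of `κ^S_∞`'s matrix**: `det(lap a S (t+z)) = det(A_S + D₋₂(S))` with `A_S = blockLegendreMatrix p S` and
`D₋₂(S) = legendreDiagonal (blockPrimes p S) (−2)` on `Fin #S` (`(−2/q)₊ = (−1/q)₊ + (2/q)₊` for odd primes `q`).
[cite: HeathBrown1994SelmerCongruentII, Appendix (Monsky), typescript p. 39 L10–L26] [cite: IrelandRosen1990, Ch. 5 §1 Prop. 5.1.2] -/
theorem det_lap_eq_det_block_neg_two (S : Finset (Fin k)) :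
    (lap (fun i j => legendreMatrix p i j) S (fun i => addLegendreSym (-1) (p i) + addLegendreSym 2 (p i))).det =
      (blockLegendreMatrix p S + legendreDiagonal (blockPrimes p S) (-2)).det := by
  set e := (S.orderIsoOfFin rfl).toEquiv with he
  rw [det_lap_eq_det_lap_reindex _ (subset_refl S) _ e]
  have hfilter : (univ : Finset (Fin S.card)).filter (fun i => (e i : Fin k) ∈ S) = univ := by
    refine filter_true_of_mem fun i _ => (e i).2
  rw [hfilter]
  congr 1
  ext x y
  rw [lap_apply, Matrix.add_apply, blockLegendreMatrix, legendreDiagonal, diagonal_apply]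
  simp only [mem_univ, and_self, if_true]
  have hq : ∀ x, blockPrimes p S x = p (e x : Fin k) := fun x => rfl
  by_cases hxy : x = y
  · subst hxy
    rw [if_pos rfl, if_pos rfl, Families.legendreMatrix_apply_self, hq,
      Literature.NumberTheory.EllipticCurves.CongruentNumberOddMonskySelmer.addLegendreSym_neg_two (hp _) (hp2 _), add_comm]
    congr 1
    refine sum_congr rfl fun y hy => ?_
    rw [Families.legendreMatrix_apply_of_ne p (fun h => (ne_of_mem_erase hy).symm (e.injective (Subtype.ext h))),
      Families.legendreMatrix_apply_of_ne (blockPrimes p S) (ne_of_mem_erase hy).symm, hq, hq]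
  · rw [if_neg hxy, if_neg hxy, add_zero,
      Families.legendreMatrix_apply_of_ne p (fun h => hxy (e.injective (Subtype.ext h))),
      Families.legendreMatrix_apply_of_ne (blockPrimes p S) hxy, hq, hq]

end MonskyEven

end Summit.BirchSwinnertonDyer.PrintCf2.QFormForest
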